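import Summits.BirchSwinnertonDyer.BirchSwinnertonDyer.Theorems.CyclotomicUntwistPSIrrIffSurjThree
import Summits.BirchSwinnertonDyer.BirchSwinnertonDyer.Theorems.CyclotomicUntwistPSRankOneUpperHalfAtThreeNonTower
import HarnessLib

/-!
# LAW L-irr3 read on the registered statements: K1/K2 of route `CyclotomicUntwist` with `Irr` in place of
# `Surj`, and the W-ALL atom «wild, `E[3]` irreducible, `ρ̄₃` not onto, rank one» reduced to the two
# tame-torsion cells (its cyclic part is VACUOUS)

Cell `pub/bsd-wall` (D-0145 line `route-BirchSwinnertonDyer-CyclotomicUntwist`), seat `bsd-line-cycu-p4`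
(width seat 4, gen 6). Helper toward the cruxes K1 `PSRankOneLowerHalfAtThree` (stmt-BirchSwinnertonDyer-21580)
and K2 `PSRankOneUpperHalfAtThree` (stmt-21581). THEOREMS ONLY (no definition, no named fact, no
`sorry`); BSD is not proved by this file, no crux and no W-ALL atom is closed by it. Fourth file of LAW
L-irr3 (`…PSIrrIffSurjThree.surj_three_iff_irr_of_cyclic`: on the cyclic wild cell at `3`,
`Surj W 3 ↔ Irr W 3`; `tameTorsionCell_of_irr_of_not_surj`).

* §1 `psRankOneLowerHalfAtThree_iff_irr`, `psRankOneUpperHalfAtThree_iff_irr` — the cruxes K1 / K2 are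
  EQUIVALENT to their variants with the binder `Irr W 3` (`E[3]` irreducible) instead of `Surj W 3`
  (`ρ̄₃` onto): on their rows (`ClassO6`, `v₃Δ_min` even) the two binders coincide. So the route's leaf
  covers every irreducible principal-series row; the only PS rows outside it are the reducible ones.
* §1b `towerSurj_three_of_irr_of_cyclic`: on the cyclic wild cell `E[3]` irreducible already forces
  `ρ̄_{E,3ⁿ}` onto for EVERY `n` (the whole `3`-adic image is `GL₂(ℤ₃)`): `Irr ⇒ Surj` (this lane) and
  `Surj ⇒` tower (cycu-p4 g3, `PSTowerOfEven.towerSurj_three_of_addv_of_surj_of_even`, Serre IV-23 with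
  `v₃(j − 1728) ≠ 3`).
* §2 the W-ALL atom `WAllExclAddWildRankOneIrrNotSurj` (`WAll/TargetAdditiveAtThreePotSSImage.lean`,
  census sub-block A3 ∩ wild): **`wAllExclAddWildRankOneIrrNotSurj_iff_tameTorsionCells`** — it is
  equivalent to its restriction to the rows with `tameTorsionCellThree (f₃, K₃) = true`, i.e.
  `(f₃, K₃) ∈ {(3, II), (3, IV*)}` (dicyclic, `v₃Δ_min ∈ {3, 9}`); its restriction to the cyclic wild cell
  (`v₃Δ_min` even) and to every other wild cell holds VACUOUSLY
  (`wAllExclAddWildRankOneIrrNotSurj_cyclic`, `…_of_not_tameTorsionCell`). This is the kernel form of the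
  census reading «PS/SCu irr-not-onto = 0; SCr irr-not-onto = 303» (route NUMBERS).

References: J.-P. Serre, Invent. Math. 15 (1972) §2.4 Prop. 15 [Serre1972]; A. Kraus, Manuscripta Math. 69
(1990) [Kraus1990]; cell dossier `bsd-wall-census/BLOCK-A-R1POTSS3-DOSSIER-v1.md` §1 (sub-block A3).
-/

-- single-conjunct summit: `Summit.BirchSwinnertonDyer.BirchSwinnertonDyer.…` repeats the name by design
set_option linter.dupNamespace false
set_option autoImplicit false

noncomputable section

open scoped Classical

namespace Summit.BirchSwinnertonDyer.BirchSwinnertonDyer.Theorems.PSIrrSurjThree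

open WeierstrassCurve Literature.NumberTheory.EllipticCurves Literature.NumberTheory.EllipticCurves.Rank1Residual
  Summit.BirchSwinnertonDyer.Rank1Residual.Additive Summit.BirchSwinnertonDyer.Rank1Residual.O5
  Summit.BirchSwinnertonDyer.BirchSwinnertonDyer.Theses.CyclotomicUntwist

/-! ### §1 K1 and K2 with `Irr W 3` in place of `Surj W 3` -/

/-- **K1 ⟺ K1 with `Irr`**: `PSRankOneLowerHalfAtThree` is equivalent to the same statement with the
binder `ρ̄_{E,3}` onto replaced by `E[3]` irreducible (`surj_three_iff_irr_of_cyclic` on its rows).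
[cite: Serre1972, §2.4 Prop. 15] [cite: Kraus1990, Théorème (p = 3)] -/
theorem psRankOneLowerHalfAtThree_iff_irr :
    PSRankOneLowerHalfAtThree ↔
      ∀ (W : WeierstrassCurve ℚ) [W.IsElliptic] [W.IsGloballyMinimal], ¬ W.HasCM → ClassO6 W 3 → Irr W 3 →
        Even (padicValInt 3 W.minimalDiscriminantInt) →
        W.minimalDiscriminantInt / 3 ^ padicValInt 3 W.minimalDiscriminantInt % 3 = 1 →
        W.analyticRank = 1 → Typed.MissingLowerBoundAt W 3 :=
  ⟨fun h W _ _ hCM hO6 hirr hev hsq hr ↦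
      h W hCM hO6 ((surj_three_iff_irr_of_cyclic W hO6 hev).mpr hirr) hev hsq hr,
    fun h W _ _ hCM hO6 hsurj hev hsq hr ↦
      h W hCM hO6 ((surj_three_iff_irr_of_cyclic W hO6 hev).mp hsurj) hev hsq hr⟩

/-- **K2 ⟺ K2 with `Irr`**: `PSRankOneUpperHalfAtThree` is equivalent to the same statement with the
binder `ρ̄_{E,3}` onto replaced by `E[3]` irreducible. [cite: Serre1972, §2.4 Prop. 15] [cite: Kraus1990, Théorème (p = 3)] -/
theorem psRankOneUpperHalfAtThree_iff_irr :
    PSRankOneUpperHalfAtThree ↔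
      ∀ (W : WeierstrassCurve ℚ) [W.IsElliptic] [W.IsGloballyMinimal], ¬ W.HasCM → ClassO6 W 3 → Irr W 3 →
        Even (padicValInt 3 W.minimalDiscriminantInt) →
        W.minimalDiscriminantInt / 3 ^ padicValInt 3 W.minimalDiscriminantInt % 3 = 1 →
        W.analyticRank = 1 → Typed.MissingUpperBoundAt W 3 :=
  ⟨fun h W _ _ hCM hO6 hirr hev hsq hr ↦
      h W hCM hO6 ((surj_three_iff_irr_of_cyclic W hO6 hev).mpr hirr) hev hsq hr,
    fun h W _ _ hCM hO6 hsurj hev hsq hr ↦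
      h W hCM hO6 ((surj_three_iff_irr_of_cyclic W hO6 hev).mp hsurj) hev hsq hr⟩

/-- **On the cyclic wild cell, `E[3]` irreducible ⟹ `ρ̄_{E,3ⁿ}` onto for every `n`** (the full
`3`-adic image `GL₂(ℤ₃)`): `Irr ⇒ Surj` (`surj_three_of_irr_of_cyclic`) and `Surj ⇒` the tower on the
even rows (`PSTowerOfEven.towerSurj_three_of_addv_of_surj_of_even`: `v₃(j − 1728) = 2v₃(c₆) − v₃Δ_min`
is even, `≠ 3`). [cite: SerreAbelianLadic1968, Ch. IV §3.4, Lemma 3 (IV-23)] [cite: Serre1972, §2.4 Prop. 15] -/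
theorem towerSurj_three_of_irr_of_cyclic (W : WeierstrassCurve ℚ) [W.IsElliptic] [W.IsGloballyMinimal]
    (hO6 : ClassO6 W 3) (hev : Even (padicValInt 3 W.minimalDiscriminantInt)) (hirr : Irr W 3) (n : ℕ) :
    W.HasSurjectiveModNGaloisRep (3 ^ n : ℕ) :=
  PSTowerOfEven.towerSurj_three_of_addv_of_surj_of_even W hO6.2.1
    (surj_three_of_irr_of_cyclic W hO6 hev hirr) hev n

/-! ### §2 The W-ALL atom «wild, irreducible, not onto, rank one» lives on the two tame-torsion cells -/

/-- **The cyclic part of `WAllExclAddWildRankOneIrrNotSurj` is VACUOUS**: on the cyclic wild cell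
(`ClassO6 W 3`, `v₃Δ_min` even) there is no curve with `E[3]` irreducible and `ρ̄₃` not onto, so the
atom's conclusion `BSDp W 3` holds there for want of rows. [cite: Serre1972, §2.4 Prop. 15]
[cite: Kraus1990, Théorème (p = 3)] -/
theorem wAllExclAddWildRankOneIrrNotSurj_cyclic :
    ∀ (W : WeierstrassCurve ℚ) [W.IsElliptic] [W.IsGloballyMinimal], ¬ W.HasCM → ClassO6 W 3 →
      Even (padicValInt 3 W.minimalDiscriminantInt) → Irr W 3 → ¬ Surj W 3 → W.analyticRank = 1 →
      BSDp W 3 :=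
  fun W _ _ _ hO6 hev hirr hns _ ↦ (hns (surj_three_of_irr_of_cyclic W hO6 hev hirr)).elim

/-- **Off the two tame-torsion cells the atom is VACUOUS**: on `ClassO6 W 3` with
`tameTorsionCellThree (f₃, K₃) = false` (every wild cell except `(f₃, K₃) ∈ {(3, II), (3, IV*)}`) there is
no irreducible-not-onto curve. [cite: Serre1972, §2.4 Prop. 15] [cite: Kraus1990, Théorème (p = 3)] -/
theorem wAllExclAddWildRankOneIrrNotSurj_of_not_tameTorsionCell :
    ∀ (W : WeierstrassCurve ℚ) [W.IsElliptic] [W.IsGloballyMinimal], ¬ W.HasCM → ClassO6 W 3 →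
      tameTorsionCellThree (condExp W 3) (W.kodairaSymbolAt (placeOf 3)) = false →
      Irr W 3 → ¬ Surj W 3 → W.analyticRank = 1 → BSDp W 3 := by
  intro W _ _ _ hO6 hcell hirr hns _
  have h := tameTorsionCell_of_irr_of_not_surj W hO6 hirr hns
  rw [hcell] at h
  exact absurd h Bool.false_ne_true

/-- **`WAllExclAddWildRankOneIrrNotSurj` ⟺ its restriction to the two tame-torsion cells**
`(f₃, K₃) ∈ {(3, II), (3, IV*)}` (`tameTorsionCellThree = true`; dicyclic rows with `v₃Δ_min ∈ {3, 9}`):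
everywhere else on the wild cell an irreducible `E[3]` has onto `ρ̄₃` (`tameTorsionCell_of_irr_of_not_surj`).
The census sub-block «A3 ∩ wild» is confined to these two cells by a theorem, not by a table.
[cite: Serre1972, §2.4 Prop. 15] [cite: Kraus1990, Théorème (p = 3)] -/
theorem wAllExclAddWildRankOneIrrNotSurj_iff_tameTorsionCells :
    WAllExclAddWildRankOneIrrNotSurj ↔
      ∀ (W : WeierstrassCurve ℚ) [W.IsElliptic] [W.IsGloballyMinimal], ¬ W.HasCM → ClassO6 W 3 →
        tameTorsionCellThree (condExp W 3) (W.kodairaSymbolAt (placeOf 3)) = true →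
        Irr W 3 → ¬ Surj W 3 → W.analyticRank = 1 → BSDp W 3 := by
  refine ⟨fun h W _ _ hCM hO6 _ hirr hns hr ↦ h W hCM hO6 hirr hns hr, fun h W _ _ hCM hO6 hirr hns hr ↦ ?_⟩
  exact h W hCM hO6 (tameTorsionCell_of_irr_of_not_surj W hO6 hirr hns) hirr hns hr

end Summit.BirchSwinnertonDyer.BirchSwinnertonDyer.Theorems.PSIrrSurjThree

end
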